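import Summits.QuantumFields.YangMills.Theorems.BalabanUVNodesN15SiteCurvedOperatorEntries
import Summits.QuantumFields.YangMills.Theorems.BalabanUVNodesN15SiteCurvedColouredLayerControl
import Summits.QuantumFields.YangMills.Theorems.BalabanUVNodesN15PairedFamilyGuard
import Literature.MathematicalPhysics.QuantumFieldTheory.King1986.CovarianceQstarRate
import HarnessLib

/-!
# Route «BalabanUVNodes», cluster K4 «SpineRates» — node N15 = NE2: THE SITE LAYER WITH THE BACKGROUND LIVE IN THE TwoGrid ENTRY CURRENCY, XXXVII — THE CURVED KING FAMILY AS
# `NE2Carriers`: the unit layer by King's block-field covariance step, the SITE layer of part XXXIII re-indexed, the family `Live` (dag-n15-w2's guard), and `Live ∧ N15At` modulo the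
# two displayed operator rows of part XXXVI (entries 2 and 3)

Cell `pub-ymgap`, WIDTH SEAT `pub-ymgap-dag-n15-w1` (generation 5; director-ym №197 ∕ HUMAN RULING D-0149, №219 (1); chair R455 (A) ∕ R461; dag-lead KEY MAP v2 INBOX l.35754;
the located sequel (o1) of dag-n15-e g15 INBOX l.39322 ∕ l.39620; CLAIM-2).  `bears_on: R4∕N15 · K3⁸ SpineGivenEndpointR13SepCoPHV (stmt-QuantumFields-27366; K3⁷ 20544 aside =
lineage)`.  Filed `--supports stmt-QuantumFields-27366 --as helper` — COUNT-NEUTRAL.  Plumbing `def`s (`curvKunit`, `curvUnitDist`, `curvCarriers`), the rest theorems; 0 `sorry`.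
Imports BY NAME part XXXVI `…N15SiteCurvedOperatorEntries` (`curvPI`, `curvKop`, `ne2PlusOperator_curvKop_of_rows23`), part XXXIII (`ne2PlusSite_curvColSite`, `cSiteExOn`, `curvPf∕curvPc`),
part XXXIV `…Control` (`exists_curvIndex_size_levels_ge`), dag-n15-w2's `…N15PairedFamilyGuard` (`Live`), dag-n16∕n19's `…SpineRates` (`NE2Carriers`, `N15At`), the typed King leaf
`King1986.CovarianceQstarRate` (`effLaplacian_inv_sub_decay`, `CdiffM`, `kapM` — [King1986] Lemma 4.5 (4.38) p. 674 with (4.39)–(4.41)), `NE2NodeTorus` (`ne2PlusSite_reindex`);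
nothing in the tree is modified.

WHY.  dag-n15-e's Λ (`…KingModelLive`, p587186∕p590020) bundles a King-model family as `NE2Carriers` with `PairedFamilyGuard.Live c ∧ N15At c`.  For the curved King family of parts
XXX–XXXVI (exact adjoint-transporter dressing, potentials in the (3.35) window, `M_sz` and `K` free) the SITE layer is part XXXIII, the OPERATOR layer is part XXXVI modulo its two
displayed rows, and the UNIT layer is typed here as King's `A = 0` block-field covariance step `(Δ^{(K+1)})⁻¹(b, b′) − (Δ^{(K)})⁻¹(b, b′)` on the family's unit torus (U-blind, massive
`m² > 0` — the massless unit-lattice covariance is singular on the torus; exactly Λ's unit layer), whose η-rate IS the typed King Lemma 4.5.  The guard `Live` holds: `M_sz` and `K`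
jointly cofinal (part XXXIV), the trivial potential regular (`c₃₅ ≥ 0`), the unit region met.

CONTENTS.  §1 `curvKunit`, `curvUnitDist`, `curvCarriers` (index `KingVolIndex d × Fin (d+1)`; `Kop := curvKop`, `Ksite := cSiteExOn … c c′ ∘ fst`, `inΛ := ⊤`); §2 ★ `ne2PlusUnit_curvKunit`
(`NE2PlusUnit` by name: `(δ₀, a₀, B₀, θ) = (κ_M∕2, 1, C_diff + 1, L⁻¹)`), `ne2PlusSite_curvCarriers` (part XXXIII re-indexed), ★ `live_curvCarriers`; §3 ★★★
`live_and_n15At_curvCarriers_of_rows23` (`Live c ∧ N15At c` from the displayed rows `h2`, `h3` of part XXXVI — operator layer XXXVI, site layer XXXIII, unit layer §2).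

HONEST FRAMING ∕ LIMITS.  Count-neutral KNIT; no new analytic estimate.  MODEL-LEVEL throughout (King's `A = 0` objects dressed by exact adjoint transporters of a small potential; ONE
blocking step; block-mean coarse potential; flat base point; the unit layer U-BLIND and massive); entry 2's row is the located CZ obstruction of part XXXVI (not owed by a landed letter),
entry 3's row reducible to dag-n15-e's Laplacian letters (not typed).  NOT Bałaban's `G(U)` ∕ `C^{(k)}(U)`; nothing of [B5]∕[B6]∕[B9] asserted ((3.35)–(3.37) p. 396, Thm 3.1 (3.42)
p. 397, Thm 3.2 (3.48) p. 398, Thm 3.15 (3.187) p. 432 = SHAPES; [King1986] Lemma 4.5 (4.38) p. 674, (4.39)–(4.41) pp. 674–675 = the typed model).  NE2⁺ NOT PRINTED ∕ NOT proved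
for d = 4; **N15 is NOT discharged**; K3⁸ OPEN, not claimed, skeleton v6 untouched (its N15 pin is `fullGSizedObjects`; nothing here re-pins; `KeyedLive` untouched); counts of record
UNMOVED (typed 28∕28 · discharged 5∕27, A 5∕28); one finite four-torus programme at fixed `ε` — NOT ℝ⁴, NOT infinite volume, NOT OS, NOT a mass gap, NOT Clay; R4 closes the
conditional finite-𝕋⁴ rung `BalabanLadder.UV` only.  Restate-immune (no Theses import).
-/

set_option autoImplicit false

noncomputable section
open scoped BigOperators Matrix Matrix.Norms.Frobenius

namespace Summit.QuantumFields.YangMills.BalabanUVNodes.N15.SiteLayerBg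

open Real Finset NormedSpace
open Literature.MathematicalPhysics.QuantumFieldTheory.Balaban1983to89
open Literature.MathematicalPhysics.QuantumFieldTheory.Balaban1983to89.B11SectG (BlockNorm HasMaj)
open Literature.MathematicalPhysics.QuantumFieldTheory.Balaban1983to89.T4EtaRate (PairedInstance EtaPairing NE2PlusOperator NE2PlusSite NE2PlusUnit EtaRateIneqUnit)
open Literature.MathematicalPhysics.QuantumFieldTheory.Balaban1983to89.T4EtaRateDefect (idef)
open Literature.MathematicalPhysics.QuantumFieldTheory.Balaban1983to89.T4EtaRateCoeffDefect (pull)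
open Literature.MathematicalPhysics.QuantumFieldTheory.Balaban1983to89.B5Prop11Plancherel (Tor fine unitVec)
open Literature.MathematicalPhysics.QuantumFieldTheory.Balaban1983to89.NE2NodeTorus (ne2PlusSite_reindex)
open Literature.MathematicalPhysics.QuantumFieldTheory.King1986 (aK)
open Literature.MathematicalPhysics.QuantumFieldTheory.King1986.Torus (blockOf tdistT tdistT_nonneg effLaplacian effLaplacian_inv_sub_decay CdiffM CdiffM_nonneg kapM
  kapM_pos_le)
open Literature.Barriers.QuantumFields (traceForm)
open Summit.QuantumFields.YangMills.BalabanUVNodes.N15.VectorPiece (unitTorusGeoS)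
open Summit.QuantumFields.YangMills.BalabanUVNodes.N15.MatrixSpecies (liftMap liftBlk)
open Summit.QuantumFields.YangMills.BalabanUVNodes.N15.BackgroundLayer (fineGeo)
open Summit.QuantumFields.YangMills.BalabanUVNodes.N15.OperatorReadout (opGeo)
open Summit.QuantumFields.YangMills.BalabanUVNodes.N15.PairedFamilyGuard (Live)
open Summit.QuantumFields.YangMills.BalabanUVNodes.N15KingModelRung (KingVolIndex)
open Summit.QuantumFields.YangMills.BalabanUVNodes.N15KingModelRung.Curved
open YMDAG.UVSplit (NE2Carriers N15At)

variable {d : ℕ} (L : ℕ) [NeZero L]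
variable {n : Type} [Fintype n] [DecidableEq n] (κ : Type) [Fintype κ] [DecidableEq κ] (e : Matrix n n ℂ ≃L[ℝ] (κ → ℝ)) (a : ℝ)

/-! ## §1 The unit layer, the carriers -/

section Data

/-- **THE UNIT-LAYER SITE KERNEL**: King's `A = 0` block-field covariance step `(Δ^{(K+1)})⁻¹(b, b′) − (Δ^{(K)})⁻¹(b, b′)` on the family's unit torus `Tor (2L^m)` at a mass `m²` (a
parameter; U-blind — it does not read the potential). [cite: King1986, (4.39)–(4.41) pp.674–675 (object); Balaban1985BackgroundPropagators, Thm 3.15 (3.187) p.432 (shape)] -/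
def curvKunit (n : Type) [Fintype n] [DecidableEq n] (m2 : ℝ) (i : KingVolIndex d × Fin (d + 1)) : B9.SiteKernel (curvPI L κ n i.1).gc (curvPI L κ n i.1).Bf :=
  ⟨fun _ b b' => (effLaplacian (L ^ 1 * L ^ i.1.K) (curvCube L i.1) (aK a L (i.1.K + 1)) (((L ^ 1 * L ^ i.1.K : ℕ) : ℝ) ^ 2) m2)⁻¹ b b' -
    (effLaplacian (L ^ i.1.K) (curvCube L i.1) (aK a L i.1.K) (((L ^ i.1.K : ℕ) : ℝ) ^ 2) m2)⁻¹ b b'⟩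

/-- `unitDist :=` King's periodic sup-distance on the unit torus (= the carrier's distance). [cite: King1986, Lemma 4.5 (4.38) p.674 (the distance |x − y|)] -/
def curvUnitDist (n : Type) [Fintype n] [DecidableEq n] (i : KingVolIndex d × Fin (d + 1)) : (curvPI L κ n i.1).gc.Site → (curvPI L κ n i.1).gc.Site → ℝ :=
  fun y y' => tdistT (curvCube L i.1) y y'

/-- **THE CURVED KING FAMILY AS N15's CARRIERS** (`YMDAG.UVSplit.NE2Carriers`): index `KingVolIndex d × Fin (d+1)` (the direction serves entries 1∕2 of the operator layer), regularity
letter `c₃₅`, site exponent `p`, paired instances part XXXVI's `curvPI`, operator kernels part XXXVI's `curvKop`, site kernels part XXXIII's coloured dressed site kernels at the colour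
selectors `(c, c′)`, unit kernels King's covariance step at mass `m²`, unit region everything, unit distance `tdistT`. [cite: Balaban1985BackgroundPropagators, Thm 3.14 pp.426–427 (typing template)] -/
def curvCarriers (c35 p m2 : ℝ) (c c' : KingVolIndex d → κ) : NE2Carriers where
  I := KingVolIndex d × Fin (d + 1)
  c35 := c35
  p := p
  pi := fun i => curvPI L κ n i.1
  Kop := curvKop L κ e a
  Ksite := fun i => cSiteExOn κ (fun i => curvCube L i) (fun i => i.K) (fun _ => 1) (fun i => i.Msz) (fun i => Tor (fine (L ^ i.K) (curvCube L i)) × κ)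
    (fun i => liftBlk (blockOf (L ^ i.K) (curvCube L i)) κ)
    (fun i => fineGeo (unitTorusGeoS L i.K (curvCube L i) i.Msz) (Tor (fine L (fine (L ^ i.K) (curvCube L i))) × κ)
      (liftBlk (blockOf (L ^ i.K) (curvCube L i) ∘ blockOf L (fine (L ^ i.K) (curvCube L i))) κ) 1)
    (curvBgC L n) (curvBgF L n) a (curvPairing L κ) (curvPf L κ e a) (curvPc L κ e a) c c' i.1
  Kunit := curvKunit L κ a n m2
  inΛ := fun _ _ => True
  unitDist := curvUnitDist L κ n

end Data

/-! ## §2 The unit layer by King's Lemma 4.5, the site layer re-indexed, the guard -/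

section Layers

omit [DecidableEq κ] in
/-- ★ **`NE2PlusUnit` BY NAME FOR THE UNIT LAYER** (`L ≥ 2`, `a, m² > 0`, any `c₃₅`): `(δ₀, a₀, B₀, θ) = (κ_M∕2, 1, C_diff + 1, L⁻¹)`, `θ^K = (L^K)⁻¹` — the typed King covariance step
`effLaplacian_inv_sub_decay` at `n = 1` on every index's unit torus. [cite: King1986, Lemma 4.5 (4.38) p.674, (4.39)–(4.41) pp.674–675; Balaban1985BackgroundPropagators, Thm 3.15 (3.187) p.432 (quantifier template)] -/
theorem ne2PlusUnit_curvKunit (hL : 2 ≤ L) (ha : 0 < a) {m2 : ℝ} (hm : 0 < m2) (c35 : ℝ) :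
    NE2PlusUnit c35 (fun i : KingVolIndex d × Fin (d + 1) => curvPI L κ n i.1) (curvKunit L κ a n m2) (fun _ _ => True) (curvUnitDist L κ n) := by
  have hLpos : (0 : ℝ) < L := by exact_mod_cast (lt_of_lt_of_le zero_lt_two hL)
  have hθ1 : (L : ℝ)⁻¹ < 1 := inv_lt_one_of_one_lt₀ (by exact_mod_cast hL)
  have hC0 : 0 ≤ CdiffM (d + 1) a m2 L := CdiffM_nonneg (d := d + 1) ha hm hL
  refine ⟨kapM (d + 1) a m2 L / 2, 1, CdiffM (d + 1) a m2 L + 1, (L : ℝ)⁻¹, half_pos (kapM_pos_le ha hm hL).1, one_pos, by linarith,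
    inv_pos.mpr hLpos, hθ1, fun i _ _ _ U _ _ b b' _ _ => ?_⟩
  have key := effLaplacian_inv_sub_decay ha hm hL i.1.one_le_K le_rfl (curvCube L i.1) b b'
  have hE : 0 ≤ Real.exp (-(kapM (d + 1) a m2 L / 2 * tdistT (curvCube L i.1) b b')) := Real.exp_nonneg _
  have hLK : 0 ≤ ((L : ℝ) ^ i.1.K)⁻¹ := by positivity
  calc |(curvKunit L κ a n m2 i).ker U b b'|
      ≤ CdiffM (d + 1) a m2 L * ((L : ℝ) ^ i.1.K)⁻¹ * Real.exp (-(kapM (d + 1) a m2 L / 2 * tdistT (curvCube L i.1) b b')) := key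
    _ ≤ (CdiffM (d + 1) a m2 L + 1) * ((L : ℝ) ^ i.1.K)⁻¹ * Real.exp (-(kapM (d + 1) a m2 L / 2 * tdistT (curvCube L i.1) b b')) :=
        mul_le_mul_of_nonneg_right (mul_le_mul_of_nonneg_right (by linarith) hLK) hE
    _ = (CdiffM (d + 1) a m2 L + 1) * Real.exp (-(kapM (d + 1) a m2 L / 2 * curvUnitDist L κ n i b b')) * ((L : ℝ)⁻¹) ^ (curvPI L κ n i.1).gc.k := by
        rw [inv_pow]; unfold curvUnitDist; ring

/-- **THE SITE LAYER OF THE CARRIERS** = part XXXIII's `ne2PlusSite_curvColSite` re-indexed along `fst`. [cite: Balaban1985BackgroundPropagators, Thm 3.2 (3.48) p.398 (quantifier template)] -/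
theorem ne2PlusSite_curvCarriers (he : ∀ X Y : Matrix n n ℂ, traceForm X Y = e X ⬝ᵥ e Y) (hLodd : Odd L) (hL : 2 ≤ L) (ha : 0 < a) (c35 p m2 : ℝ)
    (c c' : KingVolIndex d → κ) :
    NE2PlusSite 4 (curvCarriers L κ e a c35 p m2 c c').p (curvCarriers L κ e a c35 p m2 c c').c35 (curvCarriers L κ e a c35 p m2 c c').pi
      (curvCarriers L κ e a c35 p m2 c c').Ksite :=
  ne2PlusSite_reindex (fun i : KingVolIndex d × Fin (d + 1) => i.1) (ne2PlusSite_curvColSite (d := d) L κ e a he hLodd hL ha c35 4 p c c')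

/-- ★ **THE CURVED KING FAMILY IS `Live`** (dag-n15-w2's guard; `c₃₅ ≥ 0`): (G1–G3) `M_sz` and `K` jointly cofinal (part XXXIV `exists_curvIndex_size_levels_ge`), (G4) the trivial
potential `A′ = 0` is (3.35)∕(3.36)-regular at every `α₀ > 0` (its letters read `0 ≤ c₃₅·(M_sz α₀)`), (G5) the unit region (everything) is met. [folklore] -/
theorem live_curvCarriers {c35 : ℝ} (hc35 : 0 ≤ c35) (p m2 : ℝ) (c c' : KingVolIndex d → κ) : Live (curvCarriers L κ e a c35 p m2 c c') := by
  refine ⟨fun M₅ k₀ => ?_, fun i α₀ hα₀ => ?_, fun i => ⟨(0 : Tor (curvCube L i.1)), trivial⟩⟩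
  · obtain ⟨i, hM, hk⟩ := exists_curvIndex_size_levels_ge (d := d) L κ M₅ k₀
    exact ⟨(i, 0), hM, hk⟩
  · have h0 : 0 ≤ c35 * (i.1.Msz * α₀) := mul_nonneg hc35 (mul_nonneg (zero_le_one.trans i.1.one_le_Msz) hα₀.le)
    have hη : 0 ≤ ((L : ℝ) ^ (i.1.K + 1))⁻¹ * (c35 * (i.1.Msz * α₀)) := mul_nonneg (by positivity) h0
    have hskew : ∀ (μ : Fin (d + 1)) (y' : Tor (fine L (fine (L ^ i.1.K) (curvCube L i.1)))),
        ((0 : Fin (d + 1) → Tor (fine L (fine (L ^ i.1.K) (curvCube L i.1))) → Matrix n n ℂ) μ y')ᴴ =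
          -(0 : Fin (d + 1) → Tor (fine L (fine (L ^ i.1.K) (curvCube L i.1))) → Matrix n n ℂ) μ y' :=
      fun μ y' => by simp
    refine ⟨⟨hskew, fun μ y' => ?_, fun μ ν y' => ?_, fun μ ν z' => ?_⟩, hskew, fun μ y' => ?_⟩
    · show ‖(0 : Fin (d + 1) → Tor (fine L (fine (L ^ i.1.K) (curvCube L i.1))) → Matrix n n ℂ) μ y'‖ ≤ c35 * (i.1.Msz * α₀)
      simpa using h0
    · show ‖(0 : Fin (d + 1) → Tor (fine L (fine (L ^ i.1.K) (curvCube L i.1))) → Matrix n n ℂ) μ y' -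
          (0 : Fin (d + 1) → Tor (fine L (fine (L ^ i.1.K) (curvCube L i.1))) → Matrix n n ℂ) μ (y' - unitVec (fine L (fine (L ^ i.1.K) (curvCube L i.1))) ν)‖ ≤
        ((L : ℝ) ^ (i.1.K + 1))⁻¹ * (c35 * (i.1.Msz * α₀))
      simpa using hη
    · show ‖(((L : ℝ) ^ (i.1.K + 1))⁻¹)⁻¹ • ((0 : Fin (d + 1) → Tor (fine L (fine (L ^ i.1.K) (curvCube L i.1))) → Matrix n n ℂ) μ
            (z' + unitVec (fine L (fine (L ^ i.1.K) (curvCube L i.1))) ν + unitVec (fine L (fine (L ^ i.1.K) (curvCube L i.1))) μ) -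
            (0 : Fin (d + 1) → Tor (fine L (fine (L ^ i.1.K) (curvCube L i.1))) → Matrix n n ℂ) μ (z' + unitVec (fine L (fine (L ^ i.1.K) (curvCube L i.1))) ν)) -
          (((L : ℝ) ^ (i.1.K + 1))⁻¹)⁻¹ • ((0 : Fin (d + 1) → Tor (fine L (fine (L ^ i.1.K) (curvCube L i.1))) → Matrix n n ℂ) μ
            (z' + unitVec (fine L (fine (L ^ i.1.K) (curvCube L i.1))) μ) -
            (0 : Fin (d + 1) → Tor (fine L (fine (L ^ i.1.K) (curvCube L i.1))) → Matrix n n ℂ) μ z')‖ ≤ ((L : ℝ) ^ (i.1.K + 1))⁻¹ * (c35 * (i.1.Msz * α₀))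
      simpa using hη
    · show ‖(0 : Fin (d + 1) → Tor (fine L (fine (L ^ i.1.K) (curvCube L i.1))) → Matrix n n ℂ) μ y'‖ ≤ c35 * (i.1.Msz * α₀)
      simpa using h0

end Layers

/-! ## §3 ★★★ `Live ∧ N15At` modulo the two displayed operator rows -/

section Bundle

/-- ★★★ **THE CURVED KING FAMILY's `Live ∧ N15At` BUNDLE, MODULO THE DISPLAYED ROWS OF OPERATOR ENTRIES 2 AND 3** (dag-n15-e's Λ pattern for THIS family): odd `L ≥ 3`, `a > 0`,
trace-form-orthonormal coordinates `e`, `c₃₅ ≥ 0`, unit mass `m² > 0`, site exponent `p`, colour selectors `(c, c′)`; the rows `h2`, `h3` of part XXXVI §3 ⟹ `PairedFamilyGuard.Live c ∧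
N15At c` for `c = curvCarriers …` — operator layer part XXXVI `ne2PlusOperator_curvKop_of_rows23`, site layer part XXXIII, unit layer §2.  The operator AND site layers read the
potential through the EXACT adjoint transporters; the unit layer is U-blind. [cite: Balaban1985BackgroundPropagators, Thm 3.1 (3.42) p.397, Thm 3.2 (3.48) p.398, Thm 3.15 (3.187) p.432 (shapes); King1986, Lemma 4.5 (4.38) p.674, Prop. 3.9 (3.73) p.665 (model)] -/
theorem live_and_n15At_curvCarriers_of_rows23 (he : ∀ X Y : Matrix n n ℂ, traceForm X Y = e X ⬝ᵥ e Y) (hLodd : Odd L) (hL : 2 ≤ L) (ha : 0 < a) {c35 : ℝ} (hc35 : 0 ≤ c35)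
    {m2 : ℝ} (hm : 0 < m2) (p : ℝ) (c c' : KingVolIndex d → κ)
    (h2 : ∃ δ₂ C₂ b₂ : ℝ, 0 < δ₂ ∧ 0 < C₂ ∧ 0 < b₂ ∧
      ∀ (i : KingVolIndex d × Fin (d + 1)) (α₀ : ℝ), 0 < α₀ → i.1.Msz * α₀ ≤ b₂ → ∀ U : (curvBgF L n i.1).Cfg, (curvBgF L n i.1).Reg335 c35 α₀ U →
        HasMaj (BlockNorm.ofBlocks (unitTorusGeoS L i.1.K (curvCube L i.1) i.1.Msz) (liftBlk (blockOf (L ^ i.1.K) (curvCube L i.1)) κ))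
          (BlockNorm.ofBlocks (unitTorusGeoS L i.1.K (curvCube L i.1) i.1.Msz) (liftBlk (blockOf (L ^ i.1.K) (curvCube L i.1) ∘ blockOf L (fine (L ^ i.1.K) (curvCube L i.1))) κ))
          (curvOpT L κ e a i 2 U) (fun y y' => C₂ * ((L : ℝ) ^ i.1.K) ^ (-(1 / 4 : ℝ)) * Real.exp (-(δ₂ * tdistT (curvCube L i.1) y y'))))
    (h3 : ∃ δ₃ C₃ b₃ : ℝ, 0 < δ₃ ∧ 0 < C₃ ∧ 0 < b₃ ∧
      ∀ (i : KingVolIndex d × Fin (d + 1)) (α₀ : ℝ), 0 < α₀ → i.1.Msz * α₀ ≤ b₃ → ∀ U : (curvBgF L n i.1).Cfg, (curvBgF L n i.1).Reg335 c35 α₀ U →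
        HasMaj (BlockNorm.ofBlocks (unitTorusGeoS L i.1.K (curvCube L i.1) i.1.Msz) (liftBlk (blockOf (L ^ i.1.K) (curvCube L i.1)) κ))
          (BlockNorm.ofBlocks (unitTorusGeoS L i.1.K (curvCube L i.1) i.1.Msz) (liftBlk (blockOf (L ^ i.1.K) (curvCube L i.1) ∘ blockOf L (fine (L ^ i.1.K) (curvCube L i.1))) κ))
          (curvOpT L κ e a i 3 U) (fun y y' => C₃ * ((L : ℝ) ^ i.1.K) ^ (-(1 / 4 : ℝ)) * Real.exp (-(δ₃ * tdistT (curvCube L i.1) y y')))) :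
    Live (curvCarriers L κ e a c35 p m2 c c') ∧ N15At (curvCarriers L κ e a c35 p m2 c c') :=
  ⟨live_curvCarriers L κ e a hc35 p m2 c c',
    ne2PlusOperator_curvKop_of_rows23 (d := d) L κ e a he hLodd hL ha c35 h2 h3,
    ne2PlusSite_curvCarriers L κ e a he hLodd hL ha c35 p m2 c c',
    ne2PlusUnit_curvKunit L κ a hL ha hm c35⟩

end Bundle

end Summit.QuantumFields.YangMills.BalabanUVNodes.N15.SiteLayerBg

end
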